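import Literature.LinearAlgebra.Matrix.BipartiteForestFormula
import Literature.LinearAlgebra.Matrix.AdjugateKernelLine
import Literature.NumberTheory.EllipticCurves.Smith2016.CongruentNumberGenusDeterminantBlocks
import HarnessLib

/-!
# Route `PrintCf2`, crux stmt-BirchSwinnertonDyer-20509 `RamifiedOffTYZOfFacts` — the Q-form identity (★): RE-INDEXING TOOLS (F5a)
# (cell `bsd-print-cf2`, LEAD of 20509 g6, line `offtyz-v7`, cycle 7; kernel helpers `--supports stmt-BirchSwinnertonDyer-20509`)

Generic linear algebra over `𝔽₂` used to carry the forest-language form of (★) (`…QFormMonsky`) over to g5's block vocabulary `QForm.*`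
(crux workfile `Cruxes/RamifiedOffTYZOfFacts/Lines/offtyz_v7_QFormProof.md` §2, §9 F5):
* `det_bigN_eq_det_bigN_reindex` — the ambient doubled matrix `bigN a T y z ℓ` (unit padding outside `T`) has the determinant of the doubled
  matrix of the sub-tuple indexed by `Fin m` along any `e : Fin m ≃ T` (block-triangular determinant + re-indexing);
* `det_lap_eq_det_lap_reindex` — the same for the Laplacian-type block `lap a D ℓ`, `D ⊆ S`, `e : Fin m ≃ S`;
* `det_eq_det_of_mulVec_eq_zero_iff` — over `𝔽₂`, equal kernels give equal determinants; `bigN_congr_offdiag` — `bigN` reads only the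
  off-diagonal weights; `adjugate_lap_univ_zero_self` — `adj(L)_{xx} = κ_x`;
* `kerSum_apply_eq_adjugate_of_one_vecMul` — for `𝟙ᵀ Q = 0` (columns summing to zero, e.g. the real Rédei matrix of an even block) the kernel sum
  `Σ_{v : Q v = 0} v` is the diagonal of `adj Q` (line kernel: rows of the adjugate are constant; larger kernel: both vanish).
Pure linear algebra; no `sorry`. BSD is not proved by any of this; no class is closed.

References: [cite: Chaiken1982, §2]; [cite: ChebotarevAgaev2002, §3 Thm. 1–2]; [cite: HornJohnson2013, §0.8.2].
-/

namespace Summit.BirchSwinnertonDyer.PrintCf2.QFormForest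

open Matrix Finset Literature.LinearAlgebra.Matrix Literature.Combinatorics.Enumerative

variable {V : Type*} [Fintype V] [LinearOrder V]


section Reindex

omit [Fintype V] in
/-- Outside the two copies `T ⊕ T` (`= T.disjSum T`) the doubled matrix `bigN a T y z ℓ` is the identity, with no entries into the copies.
[cite: Chaiken1982, §2] -/
theorem bigN_apply_of_not_mem_disjSum (a : V → V → ZMod 2) (T : Finset V) (y z ℓ : V → ZMod 2) {i : V ⊕ V}
    (hi : i ∉ T.disjSum T) (j : V ⊕ V) : bigN a T y z ℓ i j = if i = j then 1 else 0 := by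
  rcases i with i | i <;> rcases j with j | j
  · rw [Finset.inl_mem_disjSum] at hi
    rw [bigN_inl_inl]
    by_cases hij : i = j
    · subst hij; simp [hi]
    · rw [if_neg hij, if_neg (fun h => hij (Sum.inl_injective h))]
  · rw [Finset.inl_mem_disjSum] at hi
    rw [bigN_inl_inr, lapIn_apply, if_neg (fun h => hi h.2), if_neg Sum.inl_ne_inr]
  · rw [Finset.inr_mem_disjSum] at hi
    rw [bigN_inr_inl, lapIn_apply, if_neg (fun h => hi h.1), if_neg Sum.inr_ne_inl]
  · rw [Finset.inr_mem_disjSum] at hi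
    rw [bigN_inr_inr]
    by_cases hij : i = j
    · subst hij; simp [hi]
    · rw [if_neg hij, if_neg (fun h => hij (Sum.inr_injective h))]

/-- **The doubled matrix of a block, re-indexed**: for `e : Fin m ≃ T`, `det (bigN a T y z ℓ)` (ambient, unit padding outside `T`) equals
`det (bigN a' univ y' z' ℓ')` for the transported data `a' i j = a (e i) (e j)`, `y' = y ∘ e`, … on `Fin m`.
[cite: Chaiken1982, §2 (all minors matrix tree theorem)] -/
theorem det_bigN_eq_det_bigN_reindex (a : V → V → ZMod 2) (T : Finset V) (y z ℓ : V → ZMod 2) {m : ℕ}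
    (e : Fin m ≃ {x // x ∈ T}) :
    (bigN a T y z ℓ).det =
      (bigN (fun i j => a (e i : V) (e j : V)) (univ : Finset (Fin m)) (fun i => y (e i : V)) (fun i => z (e i : V))
        (fun i => ℓ (e i : V))).det := by
  set N := bigN a T y z ℓ with hN
  set A' := bigN (fun i j => a (e i : V) (e j : V)) (univ : Finset (Fin m)) (fun i => y (e i : V)) (fun i => z (e i : V))
        (fun i => ℓ (e i : V)) with hA'
  rw [twoBlockTriangular_det N (fun x => x ∈ T.disjSum T)
    (fun i hi j _ => by rw [hN, bigN_apply_of_not_mem_disjSum a T y z ℓ hi j, if_neg (by rintro rfl; exact hi ‹_›)])]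
  -- the complementary block is the identity
  have hone : N.toSquareBlockProp (fun i => ¬ i ∈ T.disjSum T) = 1 := by
    ext ⟨i, hi⟩ ⟨j, hj⟩
    rw [toSquareBlockProp_def, Matrix.of_apply, hN, bigN_apply_of_not_mem_disjSum a T y z ℓ hi j, Matrix.one_apply]
    by_cases hij : i = j
    · subst hij; simp
    · rw [if_neg hij, if_neg (fun h => hij (congrArg Subtype.val h))]
  rw [hone, det_one, mul_one]
  -- the block of the copies, re-indexed by `Fin m ⊕ Fin m`
  have hsum : ∀ (f : V → ZMod 2) (j : Fin m), ∑ k ∈ T.erase (e j : V), f k = ∑ k' ∈ univ.erase j, f (e k' : V) := by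
    intro f j
    refine (sum_bij' (fun k' _ => (e k' : V)) (fun k hk => e.symm ⟨k, mem_of_mem_erase hk⟩) ?_ ?_ ?_ ?_ ?_).symm
    · intro k' hk'
      rw [mem_erase] at hk' ⊢
      exact ⟨fun h => hk'.1 (e.injective (Subtype.ext h)), (e k').2⟩
    · intro k hk
      rw [mem_erase] at hk ⊢
      refine ⟨fun h => hk.1 ?_, mem_univ _⟩
      have := congrArg (fun x => ((e x : {x // x ∈ T}) : V)) h
      simpa using this
    · intro k' _; simp
    · intro k hk; simp
    · intro k hk; simp
  -- the re-indexing equivalence `Fin m ⊕ Fin m ≃ T ⊕ T`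
  let ε : Fin m ⊕ Fin m ≃ {x : V ⊕ V // x ∈ T.disjSum T} :=
    { toFun := fun u => match u with
        | Sum.inl i => ⟨Sum.inl (e i : V), Finset.inl_mem_disjSum.mpr (e i).2⟩
        | Sum.inr i => ⟨Sum.inr (e i : V), Finset.inr_mem_disjSum.mpr (e i).2⟩
      invFun := fun x => match x with
        | ⟨Sum.inl v, hv⟩ => Sum.inl (e.symm ⟨v, Finset.inl_mem_disjSum.mp hv⟩)
        | ⟨Sum.inr v, hv⟩ => Sum.inr (e.symm ⟨v, Finset.inr_mem_disjSum.mp hv⟩)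
      left_inv := by rintro (i | i) <;> simp
      right_inv := by rintro ⟨x | x, hx⟩ <;> simp }
  have hentry : ∀ u w : Fin m ⊕ Fin m, N ((ε u) : V ⊕ V) ((ε w) : V ⊕ V) = A' u w := by
    have hinj : ∀ i j : Fin m, ((e i : V) = (e j : V)) ↔ i = j := fun i j =>
      ⟨fun h => e.injective (Subtype.ext h), fun h => by rw [h]⟩
    rintro (i | i) (j | j)
    · show N (Sum.inl (e i : V)) (Sum.inl (e j : V)) = A' (Sum.inl i) (Sum.inl j)
      rw [hN, hA', bigN_inl_inl, bigN_inl_inl]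
      simp only [(e i).2, if_true, mem_univ, hinj]
    · show N (Sum.inl (e i : V)) (Sum.inr (e j : V)) = A' (Sum.inl i) (Sum.inr j)
      rw [hN, hA', bigN_inl_inr, bigN_inl_inr, lapIn_apply, lapIn_apply]
      simp only [(e i).2, (e j).2, and_self, if_true, mem_univ, hinj, hsum]
    · show N (Sum.inr (e i : V)) (Sum.inl (e j : V)) = A' (Sum.inr i) (Sum.inl j)
      rw [hN, hA', bigN_inr_inl, bigN_inr_inl, lapIn_apply, lapIn_apply]
      simp only [(e i).2, (e j).2, and_self, if_true, mem_univ, hinj, hsum]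
    · show N (Sum.inr (e i : V)) (Sum.inr (e j : V)) = A' (Sum.inr i) (Sum.inr j)
      rw [hN, hA', bigN_inr_inr, bigN_inr_inr]
      simp only [(e i).2, if_true, mem_univ, hinj]
  have hre : (N.toSquareBlockProp (fun x => x ∈ T.disjSum T)).submatrix ε ε = A' := by
    ext u w
    rw [submatrix_apply, toSquareBlockProp_def, Matrix.of_apply, hentry]
  have h := det_submatrix_equiv_self ε (N.toSquareBlockProp (fun x => x ∈ T.disjSum T))
  rw [hre] at h
  convert h.symm using 2


end Reindex

section DetKer

variable {n : Type*} [Fintype n] [DecidableEq n]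

/-- Over `𝔽₂` two square matrices with the same kernel have the same determinant (`det ∈ {0, 1}` and `det = 0 ⟺` a non-zero kernel vector).
[folklore] -/
theorem det_eq_det_of_mulVec_eq_zero_iff (M N : Matrix n n (ZMod 2)) (h : ∀ v, M *ᵥ v = 0 ↔ N *ᵥ v = 0) : M.det = N.det := by
  have hiff : M.det = 0 ↔ N.det = 0 := by
    rw [← Matrix.exists_mulVec_eq_zero_iff, ← Matrix.exists_mulVec_eq_zero_iff]
    exact exists_congr fun v => and_congr Iff.rfl (h v)
  rcases (by decide : ∀ u : ZMod 2, u = 0 ∨ u = 1) M.det with hM | hM <;>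
    rcases (by decide : ∀ u : ZMod 2, u = 0 ∨ u = 1) N.det with hN | hN
  · rw [hM, hN]
  · exact absurd (hiff.mp hM) (by rw [hN]; exact one_ne_zero)
  · exact absurd (hiff.mpr hN) (by rw [hM]; exact one_ne_zero)
  · rw [hM, hN]

end DetKer

omit [Fintype V] in
/-- The doubled matrix only reads the OFF-diagonal arc weights. [cite: Chaiken1982, §2] -/
theorem bigN_congr_offdiag {a a' : V → V → ZMod 2} (h : ∀ i j, i ≠ j → a i j = a' i j) (D : Finset V)
    (y z ℓ : V → ZMod 2) : bigN a D y z ℓ = bigN a' D y z ℓ := by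
  have hlap : lapIn a D ℓ = lapIn a' D ℓ := by
    ext i j
    rw [lapIn_apply, lapIn_apply]
    by_cases hD : i ∈ D ∧ j ∈ D
    · rw [if_pos hD, if_pos hD]
      by_cases hij : i = j
      · rw [if_pos hij, if_pos hij, sum_congr rfl fun k hk => h i k (ne_of_mem_erase hk).symm]
      · rw [if_neg hij, if_neg hij, h i j hij]
    · rw [if_neg hD, if_neg hD]
  unfold bigN
  rw [hlap]

section KerSumOne

variable {n : Type*} [Fintype n] [DecidableEq n]

/-- **Kernel sum = adjugate diagonal for a matrix whose COLUMNS sum to zero** (`𝟙ᵀ Q = 0`, e.g. the real Rédei matrix of an even block):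
`(Σ_{v : Q v = 0} v)_α = adj(Q)_{αα}`. Line kernel `{0, v₀}`: `adj Q ≠ 0` (the left kernel of `Qᵀ` is a line), its columns lie in
`{0, v₀}`, its rows are left null vectors, hence proportional to `𝟙`, i.e. constant — so `adj_{αα} = adj_{α j₀} = (v₀)_α` for a column
`j₀ = v₀`; larger kernel: both sides vanish. [folklore] [cite: HornJohnson2013, §0.8.2] -/
theorem kerSum_apply_eq_adjugate_of_one_vecMul (Q : Matrix n n (ZMod 2)) (h1 : (fun _ => (1 : ZMod 2)) ᵥ* Q = 0) [Nonempty n]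
    (α : n) : (∑ v : n → ZMod 2, if Q *ᵥ v = 0 then v else 0) α = Q.adjugate α α := by
  have hdet : Q.det = 0 :=
    Matrix.exists_vecMul_eq_zero_iff.mp ⟨fun _ => 1, fun h => one_ne_zero (congrFun h (Classical.arbitrary n)), h1⟩
  have hcoord : (∑ v : n → ZMod 2, if Q *ᵥ v = 0 then v else 0) α =
      ∑ v ∈ (univ : Finset (n → ZMod 2)).filter (fun v => Q *ᵥ v = 0), v α := by
    rw [Finset.sum_apply, sum_filter]
    exact sum_congr rfl fun v _ => by split_ifs <;> rfl
  rw [hcoord]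
  obtain ⟨v₀, hv₀ne, hv₀⟩ := Matrix.exists_mulVec_eq_zero_iff.mpr hdet
  by_cases hline : ∀ w, Q *ᵥ w = 0 → w = 0 ∨ w = v₀
  · have hK : (univ : Finset (n → ZMod 2)).filter (fun v => Q *ᵥ v = 0) = {0, v₀} := by
      ext w
      simp only [mem_filter, mem_univ, true_and, mem_insert, mem_singleton]
      exact ⟨hline w, by rintro (rfl | rfl) <;> [exact mulVec_zero Q; exact hv₀]⟩
    rw [hK, sum_pair (Ne.symm hv₀ne), Pi.zero_apply, zero_add]
    -- `adj Q ≠ 0`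
    have hadj : Q.adjugate ≠ 0 := by
      intro h0
      have hT : Qᵀ.adjugate ≠ 0 := by
        refine Literature.LinearAlgebra.Matrix.adjugate_ne_zero_of_vecMul_line Qᵀ v₀ (fun x hx => ?_) α
        rw [vecMul_transpose] at hx
        rcases hline x hx with h | h
        · exact ⟨0, by rw [h, zero_smul]⟩
        · exact ⟨1, by rw [h, one_smul]⟩
      exact hT (by rw [← adjugate_transpose, h0, transpose_zero])
    have hcol : ∀ j, (fun i => Q.adjugate i j) = 0 ∨ (fun i => Q.adjugate i j) = v₀ :=
      fun j => hline _ (Literature.LinearAlgebra.Matrix.mulVec_adjugate_col Q hdet j)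
    -- rows of `adj Q` are left null vectors, hence constant (proportional to `𝟙`)
    have hrowconst : ∀ i j j', Q.adjugate i j = Q.adjugate i j' := by
      intro i j j'
      have hrow := Literature.LinearAlgebra.Matrix.adjugate_row_vecMul Q hdet i
      have hprop := Literature.LinearAlgebra.Matrix.vecMul_proportional_of_adjugate_ne_zero Q hadj h1 hrow
      have hj := congrFun (hprop j) j'
      have hj' := congrFun (hprop j') j
      simp only [Pi.smul_apply, smul_eq_mul, mul_one] at hj hj'
      revert hj hj'
      generalize Q.adjugate i j = u
      generalize Q.adjugate i j' = w
      revert u w; decide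
    obtain ⟨j₀, hj₀⟩ : ∃ j₀, (fun i => Q.adjugate i j₀) ≠ 0 := by
      by_contra h
      push Not at h
      exact hadj (Matrix.ext fun i j => by have := congrFun (h j) i; simpa using this)
    have hcolj₀ : (fun i => Q.adjugate i j₀) = v₀ := (hcol j₀).resolve_left hj₀
    rw [hrowconst α α j₀]
    exact (congrFun hcolj₀ α).symm
  · push Not at hline
    obtain ⟨w, hw, hw0, hwv⟩ := hline
    have hadj : Q.adjugate = 0 := by
      refine Literature.LinearAlgebra.Matrix.adjugate_eq_zero_of_mulVec_of_mulVec Q hv₀ hw ?_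
      by_contra h
      push Not at h
      obtain ⟨k, hk⟩ : ∃ k, v₀ k ≠ 0 := by
        by_contra h'
        push Not at h'
        exact hv₀ne (funext h')
      have hk1 : v₀ k = 1 := by
        have h2 : ∀ u : ZMod 2, u ≠ 0 → u = 1 := by decide
        exact h2 _ hk
      have hwk := h k
      rw [hk1, one_smul] at hwk
      rcases (by decide : ∀ u : ZMod 2, u = 0 ∨ u = 1) (w k) with h0 | h1'
      · rw [h0, zero_smul] at hwk
        exact hw0 hwk.symm
      · rw [h1', one_smul] at hwk
        exact hwv hwk.symm
    rw [hadj, Matrix.zero_apply]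
    obtain ⟨u, hu, hu0, huα⟩ : ∃ u, Q *ᵥ u = 0 ∧ u ≠ 0 ∧ u α = 0 := by
      rcases (by decide : ∀ x : ZMod 2, x = 0 ∨ x = 1) (v₀ α) with h0 | h1'
      · exact ⟨v₀, hv₀, hv₀ne, h0⟩
      rcases (by decide : ∀ x : ZMod 2, x = 0 ∨ x = 1) (w α) with h0' | h1''
      · exact ⟨w, hw, hw0, h0'⟩
      refine ⟨v₀ + w, by rw [mulVec_add, hv₀, hw, add_zero], fun h => hwv ?_, by rw [Pi.add_apply, h1', h1'']; decide⟩
      have h2 : ∀ a b : n → ZMod 2, a + b = 0 → b = a := by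
        intro a b hab; funext i
        have := congrFun hab i
        rw [Pi.add_apply, Pi.zero_apply] at this
        have h3 : ∀ x y : ZMod 2, x + y = 0 → y = x := by decide
        exact h3 _ _ this
      exact h2 _ _ h
    refine sum_involution (fun v _ => v + u) (fun v _ => ?_) (fun v _ _ => ?_) (fun v hv => ?_) (fun v _ => ?_)
    · rw [Pi.add_apply, huα, add_zero]
      exact CharTwo.add_self_eq_zero _
    · intro h
      apply hu0
      funext i
      have hi := congrFun h i
      rw [Pi.add_apply] at hi
      have h3 : ∀ x y : ZMod 2, x + y = x → y = 0 := by decide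
      exact h3 _ _ hi
    · rw [mem_filter] at hv ⊢
      exact ⟨mem_univ _, by rw [mulVec_add, hv.2, hu, add_zero]⟩
    · funext i
      rw [Pi.add_apply, Pi.add_apply, add_assoc, CharTwo.add_self_eq_zero, add_zero]

end KerSumOne


section ReindexLap

/-- **The Laplacian-type block of a sub-block, re-indexed**: for `D ⊆ S` and `e : Fin m ≃ S`,
`det (lap a D ℓ)` (ambient, unit padding) `= det (lap a' D' ℓ')` on `Fin m` with `a' i j = a (e i) (e j)`, `D' = e⁻¹(D)`, `ℓ' = ℓ ∘ e`.
[cite: ChebotarevAgaev2002, §3 Thm. 2] -/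
theorem det_lap_eq_det_lap_reindex (a : V → V → ZMod 2) {S D : Finset V} (hDS : D ⊆ S) (ℓ : V → ZMod 2) {m : ℕ}
    (e : Fin m ≃ {x // x ∈ S}) :
    (lap a D ℓ).det = (lap (fun i j => a (e i : V) (e j : V)) ((univ : Finset (Fin m)).filter (fun i => (e i : V) ∈ D))
      (fun i => ℓ (e i : V))).det := by
  set L := lap a D ℓ with hL
  set D' := (univ : Finset (Fin m)).filter (fun i => (e i : V) ∈ D) with hD'
  have hout : ∀ i, i ∉ S → ∀ j, L i j = if i = j then 1 else 0 := by
    intro i hi j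
    rw [hL, lap_apply, if_neg (fun h => hi (hDS h.1))]
  rw [twoBlockTriangular_det L (fun x => x ∈ S)
    (fun i hi j hj => by rw [hout i hi j, if_neg (by rintro rfl; exact hi hj)])]
  have hone : L.toSquareBlockProp (fun i => ¬ i ∈ S) = 1 := by
    ext ⟨i, hi⟩ ⟨j, hj⟩
    rw [toSquareBlockProp_def, Matrix.of_apply, hout i hi j, Matrix.one_apply]
    by_cases hij : i = j
    · subst hij; simp
    · rw [if_neg hij, if_neg (fun h => hij (congrArg Subtype.val h))]
  rw [hone, det_one, mul_one]
  have hmemD' : ∀ i, i ∈ D' ↔ (e i : V) ∈ D := fun i => by rw [hD', mem_filter]; simp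
  have hsum : ∀ (f : V → ZMod 2) (i : Fin m), (e i : V) ∈ D →
      ∑ k ∈ D.erase (e i : V), f k = ∑ k' ∈ D'.erase i, f (e k' : V) := by
    intro f i hiD
    refine (sum_bij' (fun k' _ => (e k' : V)) (fun k hk => e.symm ⟨k, hDS (mem_of_mem_erase hk)⟩) ?_ ?_ ?_ ?_ ?_).symm
    · intro k' hk'
      rw [mem_erase] at hk' ⊢
      exact ⟨fun h => hk'.1 (e.injective (Subtype.ext h)), (hmemD' k').mp hk'.2⟩
    · intro k hk
      rw [mem_erase] at hk ⊢
      refine ⟨fun h => hk.1 ?_, (hmemD' _).mpr ?_⟩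
      · have := congrArg (fun x => ((e x : {x // x ∈ S}) : V)) h
        simpa using this
      · simpa using hk.2
    · intro k' _; simp
    · intro k hk; simp
    · intro k hk; simp
  have hentry : ∀ i j : Fin m, L (e i : V) (e j : V) =
      lap (fun i j => a (e i : V) (e j : V)) D' (fun i => ℓ (e i : V)) i j := by
    intro i j
    have hinj : ((e i : V) = (e j : V)) ↔ i = j := ⟨fun h => e.injective (Subtype.ext h), fun h => by rw [h]⟩
    rw [hL, lap_apply, lap_apply]
    simp only [hmemD', hinj]
    by_cases hD : (e i : V) ∈ D ∧ (e j : V) ∈ D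
    · rw [if_pos hD, if_pos hD]
      by_cases hij : i = j
      · subst hij; rw [if_pos rfl, if_pos rfl, hsum _ i hD.1]
      · rw [if_neg hij, if_neg hij]
    · rw [if_neg hD, if_neg hD]
  have hre : (L.toSquareBlockProp (fun x => x ∈ S)).submatrix e e = lap (fun i j => a (e i : V) (e j : V)) D' (fun i => ℓ (e i : V)) := by
    ext i j
    rw [submatrix_apply, toSquareBlockProp_def, Matrix.of_apply, hentry]
  have h := det_submatrix_equiv_self e (L.toSquareBlockProp (fun x => x ∈ S))
  rw [hre] at h
  convert h.symm using 2

/-- `adj(L)_{xx} = κ_x` for the Laplacian-type matrix of the whole index set. [cite: ChebotarevAgaev2002, §3 Thm. 1] -/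
theorem adjugate_lap_univ_zero_self (a : V → V → ZMod 2) (x : V) : (lap a univ 0).adjugate x x = treeDet a univ x := by
  rw [adjugate_apply, ← det_unitize, Literature.NumberTheory.EllipticCurves.Smith2016.unitize_lap a (mem_univ x), treeDet]

end ReindexLap


end Summit.BirchSwinnertonDyer.PrintCf2.QFormForest
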